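import Summits.PneNP.PneNP.Theorems.OracleRefusal.Negative.TableClique
import Literature.Computability.ImplicitComplexity.SoftTypeAssignmentTySubst

/-!
# `OracleRefusal` (stmt-PneNP-1864) — negative side, II: the table clique at the STA-native interface

Crux-attack, generation 2 (refuter, 2026-08-16). The landed file `TableClique.lean` settles the typable reading of
the informal crux over LTdF's Lafont-style interface `URel.CliqueDecides` (multiplicative Booleans, nets of words).
The definer's file `SoftProgramInterpretation.lean` offers a SECOND, STA-native interface `URel.STADecides n m c L`
(the one matching the route's Thesis, which is about STA programs): `c` must answer EXACTLY `⟦0⟧` / `⟦1⟧` on the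
interpretation of EVERY typing derivation `Π ▹ ⊢ w̲ : S_m` of every word code (GMR08 data), applied with `n`
promotions. This file shows that plain obsessionality is oracle-complete at that interface too
(`sta_oracleComplete_plainObsessional`: for every `O`, `n`, `m` a clique obsessional from `1` with
`STADecides n m c O`), so that the STA-native typable form of `OracleRefusal`,
`∃ O, ∀ t n m c, 1 ≤ m → ObsessionalFrom t c → ¬ STADecides n m c O`, is false (`not_sta_oracleRefusal_plainObsessional`).
Together with `TableClique.not_oracleRefusal_plainObsessional` the verdict "for the only conjunct of `Φ⁰` with a
Lean meaning the crux is false for every oracle" is now independent of the choice of word→boolean interface; any typed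
`OracleRefusal` rests entirely on the undefined tameness conjuncts (Ehrhard-finitary, size-tame) of `Φ⁰`.

The clique (§A) is a table: one row `(nest n x)‾ ⅋ out` per word `w`, per CANONICAL result point `x ∈ staX m w` of `w̲`
(iterator copies run at the pairwise distinct exponential-free state labels `lab j` of `TableClique.lean`, letters at
the canonical points `0•1 ∈ ⟦0⟧`, `1•1 ∈ ⟦1⟧`, every argument taken with one copy, the iterator label ANY `m`-deep box
tree over these occurrence points) and per answer `out`; `nest n x = ![⋯![x]⋯]` takes one copy of the argument
(`nest_mem_argClique_iff`). It is obsessional from `1` (`obsessionalFrom_staTable`), the threshold of every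
interpretation of an affine soft derivation.

The two facts about ARBITRARY derivations of word codes that `STADecides` forces one to prove (§A.4) — every
derivation of `w̲ : S_m` has a canonical point (`word_exists`), and a canonical point of `w` is a result of no
derivation of another word (`word_unique`) — are obtained in §B by a SEMANTIC INVERSION of `STA.Deriv.interp`,
by structural recursion on derivations with the term and type constrained only propositionally (administrative rules
`(w) (m) (∀I) (∀E)` anywhere, dummies, discarded arguments, multiplexor trees of any shape, quantifier padding):
* §B.2–B.3 slot descriptions (`SlotIn`, junk trees `Junk`, wrapped leaves `Wrap`, real leaves `leafSet`) and the runs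
  of a variable (`var_runs`: one wrapped leaf, junk elsewhere; `var_exists`);
* §B.4 the types: bang counts of head arrows survive `(∀I)/(∀E)` (`ArrLike`, `BoolLike`, `WordLike`, all stable
  backwards along substitutions), and the QUANTIFIER TOWER of a variable (`var_ty`: from a non-quantified kernel `K`
  the type of `x` is `∀ʲ K⁺ʲ` — the quantifiers below an axiom are vacuous), likewise for an applied variable
  (`app1_ty`); this is what excludes, inside the recursion, the locally possible but globally untypable readings
  (a head of type `∀α.α`, a modal letter argument, a contracted tail);
* §B.5 the letters: `⟦0̲⟧ = ⟦0⟧`, `⟦1̲⟧ = ⟦1⟧` for EVERY derivation at a BoolLike type, junk context (`bool_runs`,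
  `bool_exists`); §B.6 the applied letter `c b̲` (`app1_runs`, `app1_exists`);
* §B.7–B.9 chains `c₀ b₀ (c₁ b₁ (⋯ x_z))` (`IsChain`, `chain_runs`, `chain_exists`): heads carry box trees over the
  OCCURRENCE POINTS `P‾ ⅋ (R‾ ⅋ q)` (letter label, rest label, chain value), other slots junk, every occurrence point a
  real leaf of a head slot, the tail wrapped around the last chain value or junk after a discarded rest
  (`ChainData`, `HeadsDesc`, `ChainTail`, transport `chainInv_mpx`);
* §B.10–B.11 under the binders (`lamz_runs/exists`, `word_runs_aux/word_exists_aux`).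
Interface remarks recorded on the way: (i) the descriptions of §B.7 show why the rows must be CANONICAL points: a
run may discard a rest (`R j = ![]`, tail junk) and dummies contribute `![]` leaves, so the interpretations of
different words are not disjoint at this interface either (as `TableClique.not_cliqueDecides_graph` shows for the
other one; the overlap itself is not re-proved here); (ii) `STADecides n m` is satisfiable for every `O`, `n`, `m` (the
interface is not vacuous), and the inversion lemmas of §B are the data half of the adequacy statement that
`SoftProgramInterpretation.lean` lists as its next item.

File layout (gate size limit): `StaTableDefs` (§A.1–A.3: the table, its obsessionality, rows), `StaInvSlots` …
`StaInvLamz` (§B: the inversion), `StaTable` (§B.11 word level, §A.4 the two inversion facts, §A.5 the consequences).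
-/

namespace Summit.PneNP.PneNP.Theorems.OracleRefusal.Negative

open Literature.Computability.ImplicitComplexity
open Literature.Computability.ImplicitComplexity.URel
open Literature.Computability.ImplicitComplexity.STA (Deriv Ctx Term LinTy SoftTy encWord encBit tyS tyB tyF mpxRen
  liftRen)

/-! ## §A.1 Points and cliques of the STA table -/

/-- The cliques of GMR08's letters: `false ↦ 0 = λxy.x ↦ ⟦0⟧`, `true ↦ 1 = λxy.y ↦ ⟦1⟧` (`STA.encBit`).
[cite: GaboardiMarionRonchidellarocca2008, §3.2] -/
def bitClique : Bool → Set Point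
  | false => zeroClique
  | true => oneClique

/-- GMR08's Booleans as points with axiom label `a`: `0•a = ![a]‾ ⅋ (![]‾ ⅋ a)`, `1•a = ![]‾ ⅋ (![a]‾ ⅋ a)`.
[cite: LaurentTortoraDeFalco2006, Def. 12] -/
noncomputable def bitPtAt : Bool → Point → Point
  | false, a => zeroPoint a
  | true, a => onePoint a

/-- Canonical letter points: axiom label `1`. [cite: LaurentTortoraDeFalco2006, Def. 12] -/
noncomputable def bitPt (b : Bool) : Point := bitPtAt b Point.one

/-- The canonical letter point lies in the letter's clique. [folklore] -/
theorem bitPt_mem (b : Bool) : bitPt b ∈ bitClique b := by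
  cases b
  · exact ⟨Point.one, rfl⟩
  · exact ⟨Point.one, rfl⟩

/-- `⟦0⟧` and `⟦1⟧` separate the letters. [folklore] -/
theorem eq_of_mem_bitClique {b b' : Bool} {x : Point} (h : x ∈ bitClique b) (h' : x ∈ bitClique b') : b = b' := by
  cases b <;> cases b'
  · rfl
  · exact absurd (Set.disjoint_left.1 disjoint_zeroClique_oneClique h) (fun hn => hn h')
  · exact absurd (Set.disjoint_left.1 disjoint_zeroClique_oneClique h') (fun hn => hn h)
  · rfl

/-- The answer cliques: accept (`w ∈ O`, `true`) ↦ `⟦0⟧`, reject ↦ `⟦1⟧` (GMR08's convention `0` = "true").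
[cite: GaboardiMarionRonchidellarocca2008, Def. 3.8] -/
def ansClique : Bool → Set Point
  | true => zeroClique
  | false => oneClique

/-- **Occurrence points.** The label flowing on the `j`-th copy of the iterator `c : B ⊸ α ⊸ α` of `w̲` in the
canonical run: letter argument one copy of `bitPt w_j`, state argument one copy of `lab (j+1)`, result `lab j`:
`![bitPt w_j]‾ ⅋ (![lab (j+1)]‾ ⅋ lab j)`. [cite: LaurentTortoraDeFalco2006, Def. 12] -/
noncomputable def occ (w : List Bool) (j : ℕ) : Point :=
  Point.par (Point.dual (bang1 (bitPt (w.getD j false))))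
    (Point.par (Point.dual (bang1 (lab (j + 1)))) (lab j))

/-- The set of occurrence points of `w`. [folklore] -/
def occSet (w : List Bool) : Set Point := {a | ∃ j < w.length, a = occ w j}

/-- The canonical result point of a derivation of `w̲` whose iterator slot carries the box-tree `V`:
`V‾ ⅋ (![lab |w|]‾ ⅋ lab 0)` (`z` used once at `lab |w|`, final result `lab 0`). [cite: LaurentTortoraDeFalco2006, Def. 12] -/
noncomputable def staRow (w : List Bool) (V : Point) : Point :=
  Point.par (Point.dual V) (Point.par (Point.dual (bang1 (lab w.length))) (lab 0))

/-- The canonical points of `w` at string type `S_m`: iterator label any `m`-deep box tree over occurrence points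
(`URel.argClique m`: every multiplexor tree shape, every multiplicity, dummies included). [folklore] -/
def staX (m : ℕ) (w : List Bool) : Set Point := {x | ∃ V ∈ argClique m (occSet w), x = staRow w V}

/-- The `!ⁿ⁺¹`-nested singleton box `![![⋯![x]⋯]]` — the label by which a program of type `!ⁿ S_m ⊸ B` takes ONE
copy of its argument. [cite: LaurentTortoraDeFalco2006, Def. 12] -/
noncomputable def nest : ℕ → Point → Point
  | 0, x => bang1 x
  | n + 1, x => Point.ofCourse {nest n x}

/-- **The STA table clique** of a language at the interface `!ⁿ S_m ⊸ B`: rows `(nest n x)‾ ⅋ out` for every word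
`w`, canonical point `x ∈ staX m w` and answer `out ∈ ansClique (χ_O w)`. [folklore] -/
def staTable (n m : ℕ) (O : Language Bool) : Set Point :=
  {z | ∃ (w : List Bool) (x out : Point), x ∈ staX m w ∧ out ∈ ansClique (chi O w) ∧
    z = Point.par (Point.dual (nest n x)) out}

/-! ## §A.2 The action fixes the table (obsessionality from `1`) -/

/-- `(0•a)ₜ⁽ᵏ⁾ = 0•(a)ₜ⁽ᵏ⁾` for `t ≥ 1`. [cite: LaurentTortoraDeFalco2006, Def. 13] -/
theorem act_zeroPoint {t : ℕ} (ht : 1 ≤ t) (k : ℕ) (a : Point) :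
    Point.act t k (zeroPoint a) = zeroPoint (a.act t k) := by
  simp [zeroPoint, Point.act_par, ← Point.dual_act, act_bang1 ht, act_bang0]

/-- `(1•a)ₜ⁽ᵏ⁾ = 1•(a)ₜ⁽ᵏ⁾` for `t ≥ 1`. [cite: LaurentTortoraDeFalco2006, Def. 13] -/
theorem act_onePoint {t : ℕ} (ht : 1 ≤ t) (k : ℕ) (a : Point) :
    Point.act t k (onePoint a) = onePoint (a.act t k) := by
  simp [onePoint, Point.act_par, ← Point.dual_act, act_bang1 ht, act_bang0]

/-- `⟦0⟧`/`⟦1⟧` are closed under every action with `t ≥ 1`. [cite: LaurentTortoraDeFalco2006, Prop. 8] -/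
theorem act_mem_bitClique {t : ℕ} (ht : 1 ≤ t) (k : ℕ) {b : Bool} {x : Point} (hx : x ∈ bitClique b) :
    Point.act t k x ∈ bitClique b := by
  cases b
  · obtain ⟨a, rfl⟩ := hx; exact ⟨a.act t k, (act_zeroPoint ht k a).symm⟩
  · obtain ⟨a, rfl⟩ := hx; exact ⟨a.act t k, (act_onePoint ht k a).symm⟩

/-- The answer cliques are closed under every action with `t ≥ 1`. [cite: LaurentTortoraDeFalco2006, Prop. 8] -/
theorem act_mem_ansClique {t : ℕ} (ht : 1 ≤ t) (k : ℕ) {b : Bool} {x : Point} (hx : x ∈ ansClique b) :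
    Point.act t k x ∈ ansClique b := by
  cases b
  · exact act_mem_bitClique (b := true) ht k hx
  · exact act_mem_bitClique (b := false) ht k hx

/-- The canonical letter points are fixed (`t ≥ 1`). [cite: LaurentTortoraDeFalco2006, Def. 13] -/
@[simp] theorem act_bitPt {t : ℕ} (ht : 1 ≤ t) (k : ℕ) (b : Bool) : Point.act t k (bitPt b) = bitPt b := by
  cases b
  · simp [bitPt, bitPtAt, act_zeroPoint ht]
  · simp [bitPt, bitPtAt, act_onePoint ht]

/-- Occurrence points are fixed (`t ≥ 1`). [cite: LaurentTortoraDeFalco2006, Def. 13] -/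
@[simp] theorem act_occ {t : ℕ} (ht : 1 ≤ t) (k : ℕ) (w : List Bool) (j : ℕ) :
    Point.act t k (occ w j) = occ w j := by
  simp [occ, Point.act_par, ← Point.dual_act, act_bang1 ht, act_bitPt ht, act_lab]

/-- The set of occurrence points is `t`-obsessional for `t ≥ 1`. [cite: LaurentTortoraDeFalco2006, Def. 13] -/
theorem isObsessional_occSet {t : ℕ} (ht : 1 ≤ t) (w : List Bool) : IsObsessional t (occSet w) := by
  rintro _ ⟨j, hj, rfl⟩ k _
  exact ⟨j, hj, act_occ ht k w j⟩

/-- `(nest n x)ₜ⁽ᵏ⁾ = nest n ((x)ₜ⁽ᵏ⁾)` for `t ≥ 1` (singleton boxes are small). [cite: LaurentTortoraDeFalco2006, Def. 13] -/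
theorem act_nest {t : ℕ} (ht : 1 ≤ t) (k : ℕ) : ∀ (n : ℕ) (x : Point),
    Point.act t k (nest n x) = nest n (x.act t k)
  | 0, x => act_bang1 ht k x
  | n + 1, x => by
      simp only [nest]
      rw [Point.act_ofCourse, Multiset.map_singleton, mbump_of_card_le (by simpa using ht), act_nest ht k n x]

/-- The canonical points of a word are closed under every action with `t ≥ 1`. [cite: LaurentTortoraDeFalco2006, Def. 13] -/
theorem act_mem_staX {t : ℕ} (ht : 1 ≤ t) {k : ℕ} (hk : 0 < k) {m : ℕ} {w : List Bool} {x : Point}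
    (hx : x ∈ staX m w) : Point.act t k x ∈ staX m w := by
  obtain ⟨V, hV, rfl⟩ := hx
  refine ⟨V.act t k, (isObsessional_occSet ht w).argClique ht m hV hk, ?_⟩
  simp [staRow, Point.act_par, ← Point.dual_act, act_bang1 ht, act_lab]

/-- **The STA table is obsessional from `1`.** [cite: LaurentTortoraDeFalco2006, Def. 13] -/
theorem obsessionalFrom_staTable (n m : ℕ) (O : Language Bool) : ObsessionalFrom 1 (staTable n m O) := by
  intro t ht
  rintro _ ⟨w, x, out, hx, hout, rfl⟩ k hk
  refine ⟨w, x.act t k, out.act t k, act_mem_staX ht hk hx, act_mem_ansClique ht k hout, ?_⟩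
  rw [Point.act_par, ← Point.dual_act, act_nest ht]

/-! ## §A.3 Rows: the nested singleton box takes exactly one copy -/

/-- `![a]` is injective. [cite: LaurentTortoraDeFalco2006, §5.1] -/
theorem bang1_injective : Function.Injective bang1 := fun _ _ h =>
  Multiset.singleton_inj.1 (Point.ofCourse_injective h)

/-- `nest n x ∈ argClique n A ↔ x ∈ A`: the nested singleton box is available from the `n`-fold promoted argument
exactly when `x` is one of its results. [cite: LaurentTortoraDeFalco2006, Def. 12] -/
theorem nest_mem_argClique_iff {A : Set Point} {x : Point} : ∀ {n : ℕ}, nest n x ∈ argClique n A ↔ x ∈ A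
  | 0 => by
      simp only [nest, argClique_zero, mem_liftClique]
      constructor
      · rintro (h | ⟨a, ha, h⟩)
        · exact absurd h (bang1_ne_bang0 x)
        · rwa [← bang1_injective h]
      · exact fun h => Or.inr ⟨x, h, rfl⟩
  | n + 1 => by
      rw [argClique_succ, mem_bangClique]
      simp only [nest]
      constructor
      · rintro ⟨m, hm, h⟩
        have hm' : nest n x ∈ m := by
          rw [← Point.ofCourse_injective h]; exact Multiset.mem_singleton_self _
        exact nest_mem_argClique_iff.1 (hm _ hm')
      · intro h
        exact ⟨{nest n x}, fun y hy => by rw [Multiset.mem_singleton.1 hy]; exact nest_mem_argClique_iff.2 h, rfl⟩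

/-- A point of the table applied to a label: the label IS the row's box and the answer is the row's.
[cite: LaurentTortoraDeFalco2006, Def. 12] -/
theorem row_eq {V b y out : Point} (h : Point.par (Point.dual V) b = Point.par (Point.dual y) out) :
    V = y ∧ b = out := by
  obtain ⟨h1, h2⟩ := Point.par_inj.1 h
  refine ⟨?_, h2⟩
  have := congrArg Point.dual h1
  rwa [Point.dual_dual, Point.dual_dual] at this

end Summit.PneNP.PneNP.Theorems.OracleRefusal.Negative
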